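import Mathlib.MeasureTheory.Integral.Layercake
import Mathlib.Analysis.SpecialFunctions.Pow.Integral
import Mathlib.Analysis.SpecialFunctions.ImproperIntegrals
import Literature.Analysis.FluidPDE.RieszHalfPotentialBilinearBound
import HarnessLib

/-!
# A two-level bound for bilinear convolution forms with a weak-`L^{6/5}` kernel on `ℝ³`

Analysis/FluidPDE proof file (theorems only: no definition, no named fact, no `sorry`).
Search for candidate a priori estimates; no regularity claim (cell `pub-nsfunc`, literature seat:
this file formalises one step of a PUBLISHED proof; nothing new). Second brick of the discharge of
`Literature.Analysis.FluidPDE.grujicZhang2006_localized_integral_coherence` (Grujić–Zhang,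
Comm. Math. Phys. 262 (2006), Thm. 1.2). In the proof of Thm. 1.2 (p. 563) the depleted stretching
term is bounded by `c ∫ φ²|ω|²(x) ∫ K(y)|ω(x+y)| dy dx` with a kernel `K ∈ L^{6/5}_w` and then
"we can use the same `L^p`-indices as in the proof of Theorem 1.1 — we are at the endpoint case
`q = 2`", i.e. the **weak Young inequality** `‖K ∗ f‖₃ ≤ c ‖K‖_{L^{6/5}_w} ‖f‖₂` followed by
Hölder and Gagliardo–Nirenberg. The weak Young / O'Neil inequality is absent from Mathlib and from
the tree; as for the Riesz kernel `|y|^{-5/2} ∈ L^{6/5}_w` (`RieszHalfPotentialBilinearBound.lean`,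
the `½`-Hölder case) we prove instead the cruder **two-level** form which suffices for the
Grönwall argument (the level `m` is optimised later, in the stretching estimate): for measurable
`Φ, F, k : ℝ³ → [0, ∞]` with `s^{6/5} |{k > s}| ≤ Λ` for all `s > 0`, and every `m > 0`,

  `∫ Φ(x) (∫ F(y) k(x − y) dy) dx`
    `≤ 6Λ m^{-1/5} · ‖Φ‖₂ ‖F‖₂ + (5Λ/2 · m^{4/5})^{1/2} · ‖F‖₂ ‖Φ‖₁`

(`lintegral_mul_lintegral_le_of_weak`). High levels (`k > m`): Tonelli and Cauchy–Schwarz in `x`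
for each increment, `∫Φ(x)F(x−z)dx ≤ ‖Φ‖₂‖F‖₂`, then the layer-cake bound
`∫_{k>m} k ≤ 6Λ m^{-1/5}` (`lintegral_indicator_level_lt_le_of_weak`). Low levels (`k ≤ m`):
Cauchy–Schwarz in `y` at fixed `x` and `∫_{k≤m} k² ≤ (5Λ/2) m^{4/5}`
(`lintegral_indicator_level_le_sq_le_of_weak`). All integrals are lower Lebesgue integrals.

Since the kernel of Grujić–Zhang, `λ_{Q_{2r}(x₀,t₀)}(y) = sup_{(x,t)} |(y, ξ(x+y,t), ξ(x,t))|/|y|⁴`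
((1.3) of the paper), is a supremum over an uncountable family and need not be measurable, we also
prove that a weak-`L^p` bound (stated with the outer measure) passes to a **measurable majorant**
(`exists_measurable_ge_of_weak`: hulls of the level sets at rational levels, made monotone).

## Mathlib / tree search

Mathlib (used): the layer-cake formulas `lintegral_eq_lintegral_meas_lt`,
`lintegral_rpow_eq_lintegral_meas_lt_mul`; `integral_Ioi_rpow_of_lt`, `integral_rpow`;
`ENNReal.lintegral_mul_le_Lp_mul_Lq` (Hölder), `lintegral_lintegral_swap` (Tonelli),
`lintegral_sub_left_eq_self`, `lintegral_sub_right_eq_self` (translation invariance),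
`Directed.measure_iUnion`, `ENNReal.lt_iff_exists_rat_btwn`, `measure_toMeasurable`.
`lean search 'weak.*Young|Lorentz|oneil|convolution_le.*weak'`: nothing (only the strong Young
inequality `eLpNorm_convolution_le_young` of `Literature.Analysis.PDE.NavierStokes.HeatSemigroupTorus`
on the torus and the parabolic Hedberg inequality); tree pattern followed:
`lintegral_mul_rieszHalfPotential_le_two_radii` (`RieszHalfPotentialBilinearBound.lean`).

## References

* Z. Grujić, Qi S. Zhang, *Space-time localization of a class of geometric criteria for
  preventing blow-up in the 3D NSE*, Comm. Math. Phys. 262 (2006) 555–564, proof of Thm. 1.2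
  (p. 563) and (3.7)–(3.9). [GrujicZhang2006]
* P. G. Lemarié-Rieusset, *The Navier–Stokes Problem in the 21st Century*, CRC Press (2016),
  §11.6, Thm. 11.7, proof, PDF p. 371 (the `L^{6/5,∞}` kernel bound). [LemarieRieusset2016]
-/

noncomputable section

open MeasureTheory Set Function Filter Topology Metric Real
open scoped NNReal ENNReal

namespace Literature.Analysis.FluidPDE

/-! ### A measurable majorant of a weak-`L^p` function -/

/-- **Measurable majorant under a weak-`L^p` bound** (used for Grujić–Zhang's kernel
`λ(y) = sup_{(x,t)} |(y, ξ(x+y,t), ξ(x,t))|/|y|⁴`, (1.3), a supremum over an uncountable family):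
if `k : α → [0, ∞]` is any function with `s^p μ{k > s} ≤ Λ` for all `s > 0` (`μ` the outer
measure on arbitrary sets, `p ≥ 0`), there is a measurable `k' ≥ k` with the same bound.
Construction: `k' = sup_q q·1_{T_q}` over positive rationals `q`, `T_q = ⋂_{0<q'≤q}` (measurable
hull of `{k > q'}`). [cite: GrujicZhang2006, Thm. 1.2 with (1.3) (the weak-L^{6/5} hypothesis on λ)] -/
theorem exists_measurable_ge_of_weak {α : Type*} [MeasurableSpace α] (μ : Measure α)
    (k : α → ℝ≥0∞) {p : ℝ} (hp : 0 ≤ p) (Λ : ℝ≥0∞)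
    (hk : ∀ s : ℝ, 0 < s → ENNReal.ofReal s ^ p * μ {z | ENNReal.ofReal s < k z} ≤ Λ) :
    ∃ k' : α → ℝ≥0∞, Measurable k' ∧ (∀ z, k z ≤ k' z) ∧
      ∀ s : ℝ, 0 < s → ENNReal.ofReal s ^ p * μ {z | ENNReal.ofReal s < k' z} ≤ Λ := by
  -- measurable hulls of the level sets at positive rational levels, made antitone in the level
  set S : ℚ → Set α := fun q => toMeasurable μ {z | ENNReal.ofReal ((q : ℚ) : ℝ) < k z} with hS
  set T : ℚ → Set α := fun q => ⋂ (q' : ℚ) (_ : 0 < q' ∧ q' ≤ q), S q' with hT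
  have hTm : ∀ q, MeasurableSet (T q) := fun q =>
    MeasurableSet.iInter fun q' => MeasurableSet.iInter fun _ => measurableSet_toMeasurable _ _
  have hT_anti : ∀ q₁ q₂ : ℚ, q₁ ≤ q₂ → T q₂ ⊆ T q₁ := by
    intro q₁ q₂ h z hz
    simp only [hT, mem_iInter] at hz ⊢
    exact fun q' hq' => hz q' ⟨hq'.1, hq'.2.trans h⟩
  have hT_sub : ∀ q : ℚ, 0 < q → T q ⊆ S q := by
    intro q hq z hz
    simp only [hT, mem_iInter] at hz
    exact hz q ⟨hq, le_rfl⟩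
  have hlevel_sub_T : ∀ (q : ℚ) (z : α), ENNReal.ofReal ((q : ℚ) : ℝ) < k z → z ∈ T q := by
    intro q z hz
    simp only [hT, mem_iInter]
    intro q' hq'
    refine subset_toMeasurable _ _ ?_
    show ENNReal.ofReal ((q' : ℚ) : ℝ) < k z
    exact lt_of_le_of_lt (ENNReal.ofReal_le_ofReal (by exact_mod_cast hq'.2)) hz
  -- the majorant
  set k' : α → ℝ≥0∞ := fun z =>
    ⨆ q : {q : ℚ // 0 < q}, (T q.1).indicator (fun _ => ENNReal.ofReal ((q.1 : ℚ) : ℝ)) z with hk'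
  have hk'm : Measurable k' := by
    refine Measurable.iSup fun q => ?_
    exact measurable_const.indicator (hTm q.1)
  refine ⟨k', hk'm, ?_, ?_⟩
  · -- `k ≤ k'`
    intro z
    by_contra hlt
    rw [not_le] at hlt
    obtain ⟨q, -, hq1, hq2⟩ := ENNReal.lt_iff_exists_rat_btwn.1 hlt
    have hq1' : k' z < ENNReal.ofReal ((q : ℚ) : ℝ) := hq1
    have hq2' : ENNReal.ofReal ((q : ℚ) : ℝ) < k z := hq2
    have hqpos : (0 : ℚ) < q := by
      have h0 : (0 : ℝ≥0∞) < ENNReal.ofReal ((q : ℚ) : ℝ) := lt_of_le_of_lt bot_le hq1'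
      rw [ENNReal.ofReal_pos] at h0
      exact_mod_cast h0
    have hzT : z ∈ T q := hlevel_sub_T q z hq2'
    have hle : ENNReal.ofReal ((q : ℚ) : ℝ) ≤ k' z := by
      have h := le_iSup (fun q : {q : ℚ // 0 < q} =>
        (T q.1).indicator (fun _ => ENNReal.ofReal ((q.1 : ℚ) : ℝ)) z) ⟨q, hqpos⟩
      simp only at h
      rw [indicator_of_mem hzT] at h
      exact h
    exact absurd (lt_of_le_of_lt hle hq1') (lt_irrefl _)
  · -- the weak bound
    intro s hs
    have hsub : {z | ENNReal.ofReal s < k' z} ⊆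
        ⋃ j : {q : {q : ℚ // 0 < q} // s < ((q.1 : ℚ) : ℝ)}, T j.1.1 := by
      intro z hz
      simp only [mem_setOf_eq, hk'] at hz
      rw [lt_iSup_iff] at hz
      obtain ⟨q, hq⟩ := hz
      have hzT : z ∈ T q.1 := by
        by_contra h
        rw [indicator_of_notMem h] at hq
        exact absurd hq (not_lt.2 bot_le)
      rw [indicator_of_mem hzT] at hq
      have hq0 : (0 : ℝ) < ((q.1 : ℚ) : ℝ) := by exact_mod_cast q.2
      have hsq : s < ((q.1 : ℚ) : ℝ) := (ENNReal.ofReal_lt_ofReal_iff hq0).1 hq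
      exact mem_iUnion.2 ⟨⟨q, hsq⟩, hzT⟩
    have hdir : Directed (· ⊆ ·) fun j : {q : {q : ℚ // 0 < q} // s < ((q.1 : ℚ) : ℝ)} => T j.1.1 := by
      intro j₁ j₂
      have hmin0 : (0 : ℚ) < min j₁.1.1 j₂.1.1 := lt_min j₁.1.2 j₂.1.2
      have hmins : s < ((min j₁.1.1 j₂.1.1 : ℚ) : ℝ) := by
        push_cast
        exact lt_min j₁.2 j₂.2
      refine ⟨⟨⟨min j₁.1.1 j₂.1.1, hmin0⟩, hmins⟩, ?_, ?_⟩
      · exact hT_anti _ _ (min_le_left _ _)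
      · exact hT_anti _ _ (min_le_right _ _)
    calc ENNReal.ofReal s ^ p * μ {z | ENNReal.ofReal s < k' z}
        ≤ ENNReal.ofReal s ^ p *
            μ (⋃ j : {q : {q : ℚ // 0 < q} // s < ((q.1 : ℚ) : ℝ)}, T j.1.1) :=
          mul_le_mul' le_rfl (measure_mono hsub)
      _ = ENNReal.ofReal s ^ p *
            ⨆ j : {q : {q : ℚ // 0 < q} // s < ((q.1 : ℚ) : ℝ)}, μ (T j.1.1) := by
          rw [hdir.measure_iUnion]
      _ = ⨆ j : {q : {q : ℚ // 0 < q} // s < ((q.1 : ℚ) : ℝ)}, ENNReal.ofReal s ^ p * μ (T j.1.1) :=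
          ENNReal.mul_iSup _ _
      _ ≤ Λ := iSup_le fun j => ?_
    have hj0 : (0 : ℝ) < ((j.1.1 : ℚ) : ℝ) := by exact_mod_cast j.1.2
    calc ENNReal.ofReal s ^ p * μ (T j.1.1)
        ≤ ENNReal.ofReal ((j.1.1 : ℚ) : ℝ) ^ p * μ (S j.1.1) :=
          mul_le_mul' (ENNReal.rpow_le_rpow (ENNReal.ofReal_le_ofReal j.2.le) hp)
            (measure_mono (hT_sub _ j.1.2))
      _ = ENNReal.ofReal ((j.1.1 : ℚ) : ℝ) ^ p * μ {z | ENNReal.ofReal ((j.1.1 : ℚ) : ℝ) < k z} := by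
          rw [hS]
          simp only
          rw [measure_toMeasurable]
      _ ≤ Λ := hk _ hj0

/-! ### Layer-cake bounds for the two levels of a weak-`L^{6/5}` kernel -/

/-- The level-set bound in the form `μ{k > s} ≤ Λ s^{-6/5}`. [folklore] -/
private theorem measure_level_le_of_weak {α : Type*} [MeasurableSpace α] {μ : Measure α}
    {k : α → ℝ≥0∞} {Λ : ℝ≥0∞}
    (hk : ∀ s : ℝ, 0 < s → ENNReal.ofReal s ^ (6 / 5 : ℝ) * μ {z | ENNReal.ofReal s < k z} ≤ Λ)
    {s : ℝ} (hs : 0 < s) :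
    μ {z | ENNReal.ofReal s < k z} ≤ Λ * ENNReal.ofReal (s ^ (-(6 / 5 : ℝ))) := by
  have h := hk s hs
  have ha0 : ENNReal.ofReal s ^ (6 / 5 : ℝ) ≠ 0 :=
    (ENNReal.rpow_pos (ENNReal.ofReal_pos.2 hs) ENNReal.ofReal_ne_top).ne'
  have hat : ENNReal.ofReal s ^ (6 / 5 : ℝ) ≠ ⊤ :=
    ENNReal.rpow_ne_top_of_nonneg (by norm_num) ENNReal.ofReal_ne_top
  have hinv : (ENNReal.ofReal s ^ (6 / 5 : ℝ))⁻¹ = ENNReal.ofReal (s ^ (-(6 / 5 : ℝ))) := by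
    rw [ENNReal.ofReal_rpow_of_pos hs, ← ENNReal.ofReal_inv_of_pos (Real.rpow_pos_of_pos hs _),
      Real.rpow_neg hs.le]
  calc μ {z | ENNReal.ofReal s < k z}
      = (ENNReal.ofReal s ^ (6 / 5 : ℝ))⁻¹ *
          (ENNReal.ofReal s ^ (6 / 5 : ℝ) * μ {z | ENNReal.ofReal s < k z}) := by
        rw [← mul_assoc, ENNReal.inv_mul_cancel ha0 hat, one_mul]
    _ ≤ (ENNReal.ofReal s ^ (6 / 5 : ℝ))⁻¹ * Λ := mul_le_mul' le_rfl h
    _ = Λ * ENNReal.ofReal (s ^ (-(6 / 5 : ℝ))) := by rw [hinv, mul_comm]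

/-- **The high levels of a weak-`L^{6/5}` kernel are integrable**: `∫_{k>m} k ≤ 6Λ m^{-1/5}`
(layer cake: `m·μ{k>m} + ∫_m^∞ μ{k>t} dt ≤ Λ m^{-1/5} + 5Λ m^{-1/5}`). This is the `L¹` half of
the `L^{6/5,∞} ⊂ L¹ + L²` splitting behind the weak Young inequality used by Grujić–Zhang. [cite: GrujicZhang2006, Thm. 1.2 (proof, p. 563: the kernel K ∈ L^{6/5}_w and the indices of (3.7))] -/
theorem lintegral_indicator_level_lt_le_of_weak {α : Type*} [MeasurableSpace α] {μ : Measure α}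
    {k : α → ℝ≥0∞} (hkm : Measurable k) {Λ : ℝ≥0∞}
    (hk : ∀ s : ℝ, 0 < s → ENNReal.ofReal s ^ (6 / 5 : ℝ) * μ {z | ENNReal.ofReal s < k z} ≤ Λ)
    {m : ℝ} (hm : 0 < m) :
    ∫⁻ z, {z | ENNReal.ofReal m < k z}.indicator k z ∂μ ≤ Λ * ENNReal.ofReal (6 * m ^ (-(1 / 5 : ℝ))) := by
  set B : Set α := {z | ENNReal.ofReal m < k z} with hB
  have hBm : MeasurableSet B := measurableSet_lt measurable_const hkm
  set kb : α → ℝ≥0∞ := B.indicator k with hkb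
  have hkbm : Measurable kb := hkm.indicator hBm
  -- the radial integrals in `t`
  have hmeas_t : Measurable fun t : ℝ => ENNReal.ofReal ((max t m) ^ (-(6 / 5 : ℝ))) :=
    ((measurable_id.max measurable_const).pow_const _).ennreal_ofReal
  have hI1 : ∫⁻ t in Ioc 0 m, ENNReal.ofReal ((max t m) ^ (-(6 / 5 : ℝ))) =
      ENNReal.ofReal (m ^ (-(6 / 5 : ℝ))) * ENNReal.ofReal m := by
    rw [setLIntegral_congr_fun measurableSet_Ioc
      (fun t ht => by rw [max_eq_right ht.2] :
        ∀ t ∈ Ioc (0 : ℝ) m, ENNReal.ofReal ((max t m) ^ (-(6 / 5 : ℝ))) = ENNReal.ofReal (m ^ (-(6 / 5 : ℝ)))),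
      setLIntegral_const, Real.volume_Ioc, sub_zero]
  have hI2 : ∫⁻ t in Ioi m, ENNReal.ofReal ((max t m) ^ (-(6 / 5 : ℝ))) =
      ENNReal.ofReal (5 * m ^ (-(1 / 5 : ℝ))) := by
    rw [setLIntegral_congr_fun measurableSet_Ioi
      (fun t ht => by rw [max_eq_left (le_of_lt ht)] :
        ∀ t ∈ Ioi m, ENNReal.ofReal ((max t m) ^ (-(6 / 5 : ℝ))) = ENNReal.ofReal (t ^ (-(6 / 5 : ℝ))))]
    have hint : IntegrableOn (fun t : ℝ => t ^ (-(6 / 5 : ℝ))) (Ioi m) :=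
      integrableOn_Ioi_rpow_of_lt (by norm_num) hm
    have hnn : 0 ≤ᵐ[volume.restrict (Ioi m)] fun t : ℝ => t ^ (-(6 / 5 : ℝ)) :=
      (ae_restrict_iff' measurableSet_Ioi).2
        (Eventually.of_forall fun t ht => Real.rpow_nonneg (hm.le.trans (le_of_lt ht)) _)
    rw [← ofReal_integral_eq_lintegral_ofReal hint hnn, integral_Ioi_rpow_of_lt (by norm_num) hm]
    congr 1
    rw [show -(6 / 5 : ℝ) + 1 = -(1 / 5 : ℝ) by norm_num]
    ring
  -- truncations (to apply the real-valued layer-cake formula)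
  have htrunc : ∀ N : ℕ, ∫⁻ z, min (kb z) (N : ℝ≥0∞) ∂μ ≤ Λ * ENNReal.ofReal (6 * m ^ (-(1 / 5 : ℝ))) := by
    intro N
    have hfin : ∀ z, min (kb z) (N : ℝ≥0∞) ≠ ⊤ := fun z =>
      ne_top_of_le_ne_top (ENNReal.natCast_ne_top N) (min_le_right _ _)
    set g : α → ℝ := fun z => (min (kb z) (N : ℝ≥0∞)).toReal with hg
    have hg0 : 0 ≤ᵐ[μ] g := Eventually.of_forall fun z => ENNReal.toReal_nonneg
    have hgm : AEMeasurable g μ := (hkbm.min measurable_const).ennreal_toReal.aemeasurable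
    have heq : ∫⁻ z, min (kb z) (N : ℝ≥0∞) ∂μ = ∫⁻ z, ENNReal.ofReal (g z) ∂μ :=
      lintegral_congr fun z => (ENNReal.ofReal_toReal (hfin z)).symm
    rw [heq, lintegral_eq_lintegral_meas_lt μ hg0 hgm]
    -- level sets of the truncation
    have hlev : ∀ t : ℝ, 0 < t → μ {z | t < g z} ≤ Λ * ENNReal.ofReal ((max t m) ^ (-(6 / 5 : ℝ))) := by
      intro t ht
      have hsub : {z | t < g z} ⊆ {z | ENNReal.ofReal (max t m) < k z} := by
        intro z hz
        simp only [mem_setOf_eq] at hz ⊢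
        have h1 : ENNReal.ofReal t < min (kb z) (N : ℝ≥0∞) := by
          rw [← ENNReal.ofReal_toReal (hfin z)]
          exact (ENNReal.ofReal_lt_ofReal_iff (ht.trans hz)).2 hz
        have hzB : z ∈ B := by
          by_contra hzB
          have h0 : kb z = 0 := indicator_of_notMem hzB _
          rw [h0] at h1
          exact absurd (lt_of_lt_of_le h1 (min_le_left _ _)) (not_lt.2 bot_le)
        have hkz : kb z = k z := indicator_of_mem hzB _
        have h2 : ENNReal.ofReal t < k z := lt_of_lt_of_le h1 ((min_le_left _ _).trans hkz.le)
        have h3 : ENNReal.ofReal m < k z := hzB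
        rw [ENNReal.ofReal_max]
        exact max_lt h2 h3
      exact (measure_mono hsub).trans (measure_level_le_of_weak hk (lt_max_of_lt_left ht))
    have hIoi : Ioi (0 : ℝ) = Ioc 0 m ∪ Ioi m := (Ioc_union_Ioi_eq_Ioi hm.le).symm
    have hdisj : Disjoint (Ioc (0 : ℝ) m) (Ioi m) := by
      rw [Set.disjoint_left]
      intro t ht ht'
      exact absurd ht.2 (not_le.2 ht')
    calc ∫⁻ t in Ioi 0, μ {z | t < g z}
        ≤ ∫⁻ t in Ioi 0, Λ * ENNReal.ofReal ((max t m) ^ (-(6 / 5 : ℝ))) :=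
          setLIntegral_mono' measurableSet_Ioi fun t ht => hlev t ht
      _ = Λ * ∫⁻ t in Ioi 0, ENNReal.ofReal ((max t m) ^ (-(6 / 5 : ℝ))) :=
          lintegral_const_mul _ hmeas_t
      _ = Λ * (ENNReal.ofReal (m ^ (-(6 / 5 : ℝ))) * ENNReal.ofReal m +
            ENNReal.ofReal (5 * m ^ (-(1 / 5 : ℝ)))) := by
          rw [hIoi, lintegral_union measurableSet_Ioi hdisj, hI1, hI2]
      _ = Λ * ENNReal.ofReal (6 * m ^ (-(1 / 5 : ℝ))) := by
          congr 1
          rw [← ENNReal.ofReal_mul (Real.rpow_nonneg hm.le _),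
            ← ENNReal.ofReal_add (mul_nonneg (Real.rpow_nonneg hm.le _) hm.le)
              (by positivity)]
          congr 1
          rw [← Real.rpow_add_one hm.ne', show -(6 / 5 : ℝ) + 1 = -(1 / 5 : ℝ) by norm_num]
          ring
  -- pass to the limit in the truncation
  have hmono : Monotone fun N : ℕ => fun z => min (kb z) (N : ℝ≥0∞) := by
    intro N N' h z
    exact min_le_min le_rfl (by exact_mod_cast h)
  have hsup : ∀ z, ⨆ N : ℕ, min (kb z) (N : ℝ≥0∞) = kb z := by
    intro z
    refine le_antisymm (iSup_le fun N => min_le_left _ _) ?_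
    rcases eq_or_ne (kb z) ⊤ with h | h
    · have e : (fun N : ℕ => min (kb z) (N : ℝ≥0∞)) = fun N : ℕ => (N : ℝ≥0∞) :=
        funext fun N => by rw [h]; exact min_eq_right le_top
      rw [e, ENNReal.iSup_natCast, h]
    · obtain ⟨N, hN⟩ := exists_nat_gt (kb z).toReal
      have hle : kb z ≤ (N : ℝ≥0∞) := by
        rw [← ENNReal.ofReal_toReal h, ← ENNReal.ofReal_natCast N]
        exact ENNReal.ofReal_le_ofReal hN.le
      exact le_iSup_of_le N (le_min le_rfl hle)
  calc ∫⁻ z, kb z ∂μ = ∫⁻ z, ⨆ N : ℕ, min (kb z) (N : ℝ≥0∞) ∂μ :=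
        lintegral_congr fun z => (hsup z).symm
    _ = ⨆ N : ℕ, ∫⁻ z, min (kb z) (N : ℝ≥0∞) ∂μ :=
        lintegral_iSup (fun N => hkbm.min measurable_const) hmono
    _ ≤ Λ * ENNReal.ofReal (6 * m ^ (-(1 / 5 : ℝ))) := iSup_le htrunc

/-- **The low levels of a weak-`L^{6/5}` kernel are square integrable**:
`∫_{k≤m} k² ≤ (5Λ/2) m^{4/5}` (layer cake: `∫_0^m 2t μ{k>t} dt ≤ 2Λ∫_0^m t^{-1/5} dt`). This is
the `L²` half of the `L^{6/5,∞} ⊂ L¹ + L²` splitting behind the weak Young inequality used by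
Grujić–Zhang. [cite: GrujicZhang2006, Thm. 1.2 (proof, p. 563: the kernel K ∈ L^{6/5}_w and the indices of (3.7))] -/
theorem lintegral_indicator_level_le_sq_le_of_weak {α : Type*} [MeasurableSpace α] {μ : Measure α}
    {k : α → ℝ≥0∞} (hkm : Measurable k) {Λ : ℝ≥0∞}
    (hk : ∀ s : ℝ, 0 < s → ENNReal.ofReal s ^ (6 / 5 : ℝ) * μ {z | ENNReal.ofReal s < k z} ≤ Λ)
    {m : ℝ} (hm : 0 < m) :
    ∫⁻ z, ({z | ENNReal.ofReal m < k z}ᶜ.indicator k z) ^ 2 ∂μ ≤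
      Λ * ENNReal.ofReal (5 / 2 * m ^ (4 / 5 : ℝ)) := by
  set A : Set α := {z | ENNReal.ofReal m < k z}ᶜ with hA
  have hAm : MeasurableSet A := (measurableSet_lt measurable_const hkm).compl
  set ks : α → ℝ≥0∞ := A.indicator k with hks
  have hksm : Measurable ks := hkm.indicator hAm
  have hks_le : ∀ z, ks z ≤ ENNReal.ofReal m := fun z => by
    by_cases hz : z ∈ A
    · rw [hks, indicator_of_mem hz]
      exact not_lt.1 hz
    · rw [hks, indicator_of_notMem hz]
      exact bot_le
  have hfin : ∀ z, ks z ≠ ⊤ := fun z => ne_top_of_le_ne_top ENNReal.ofReal_ne_top (hks_le z)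
  set g : α → ℝ := fun z => (ks z).toReal with hg
  have hg0 : 0 ≤ᵐ[μ] g := Eventually.of_forall fun z => ENNReal.toReal_nonneg
  have hgm : AEMeasurable g μ := hksm.ennreal_toReal.aemeasurable
  have hg_le : ∀ z, g z ≤ m := fun z => by
    have h := ENNReal.toReal_mono ENNReal.ofReal_ne_top (hks_le z)
    rwa [ENNReal.toReal_ofReal hm.le] at h
  have heq : ∫⁻ z, ks z ^ 2 ∂μ = ∫⁻ z, ENNReal.ofReal (g z ^ (2 : ℝ)) ∂μ :=
    lintegral_congr fun z => by
      rw [Real.rpow_two, ENNReal.ofReal_pow ENNReal.toReal_nonneg, ENNReal.ofReal_toReal (hfin z)]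
  rw [heq, lintegral_rpow_eq_lintegral_meas_lt_mul μ hg0 hgm (by norm_num : (0 : ℝ) < 2)]
  -- level sets
  have hlev : ∀ t : ℝ, 0 < t → μ {z | t < g z} * ENNReal.ofReal (t ^ ((2 : ℝ) - 1)) ≤
      (Iio m).indicator (fun t => Λ * ENNReal.ofReal (t ^ (-(1 / 5 : ℝ)))) t := by
    intro t ht
    by_cases htm : t < m
    · rw [indicator_of_mem (show t ∈ Iio m from htm)]
      have hsub : {z | t < g z} ⊆ {z | ENNReal.ofReal t < k z} := by
        intro z hz
        simp only [mem_setOf_eq] at hz ⊢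
        have h1 : ENNReal.ofReal t < ks z := by
          rw [← ENNReal.ofReal_toReal (hfin z)]
          exact (ENNReal.ofReal_lt_ofReal_iff (ht.trans hz)).2 hz
        have hzA : z ∈ A := by
          by_contra hzA
          have h0 : ks z = 0 := indicator_of_notMem hzA _
          rw [h0] at h1
          exact absurd h1 (not_lt.2 bot_le)
        have hkz : ks z = k z := indicator_of_mem hzA _
        rwa [hkz] at h1
      calc μ {z | t < g z} * ENNReal.ofReal (t ^ ((2 : ℝ) - 1))
          ≤ (Λ * ENNReal.ofReal (t ^ (-(6 / 5 : ℝ)))) * ENNReal.ofReal (t ^ ((2 : ℝ) - 1)) :=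
            mul_le_mul' ((measure_mono hsub).trans (measure_level_le_of_weak hk ht)) le_rfl
        _ = Λ * ENNReal.ofReal (t ^ (-(1 / 5 : ℝ))) := by
            rw [mul_assoc, ← ENNReal.ofReal_mul (Real.rpow_nonneg ht.le _), ← Real.rpow_add ht,
              show -(6 / 5 : ℝ) + ((2 : ℝ) - 1) = -(1 / 5 : ℝ) by norm_num]
    · rw [indicator_of_notMem (show t ∉ Iio m from htm)]
      have hempty : {z | t < g z} = ∅ := by
        ext z
        simp only [mem_setOf_eq, mem_empty_iff_false, iff_false, not_lt]
        exact (hg_le z).trans (not_lt.1 htm)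
      rw [hempty, measure_empty, zero_mul]
  -- the radial integral `∫_0^m t^{-1/5} dt = (5/4) m^{4/5}`
  have hJ : ∫⁻ t in Ioo 0 m, ENNReal.ofReal (t ^ (-(1 / 5 : ℝ))) = ENNReal.ofReal (5 / 4 * m ^ (4 / 5 : ℝ)) := by
    have hint : IntegrableOn (fun t : ℝ => t ^ (-(1 / 5 : ℝ))) (Ioo 0 m) :=
      (intervalIntegral.intervalIntegrable_rpow' (by norm_num : (-1 : ℝ) < -(1 / 5 : ℝ))
        (a := 0) (b := m)).1.mono_set Ioo_subset_Ioc_self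
    have hnn : 0 ≤ᵐ[volume.restrict (Ioo 0 m)] fun t : ℝ => t ^ (-(1 / 5 : ℝ)) :=
      (ae_restrict_iff' measurableSet_Ioo).2
        (Eventually.of_forall fun t ht => Real.rpow_nonneg (le_of_lt ht.1) _)
    rw [← ofReal_integral_eq_lintegral_ofReal hint hnn, ← integral_Ioc_eq_integral_Ioo,
      ← intervalIntegral.integral_of_le hm.le,
      integral_rpow (Or.inl (by norm_num : (-1 : ℝ) < -(1 / 5 : ℝ)))]
    congr 1
    rw [show -(1 / 5 : ℝ) + 1 = 4 / 5 by norm_num, Real.zero_rpow (by norm_num)]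
    ring
  have hmeas_t : Measurable fun t : ℝ => ENNReal.ofReal (t ^ (-(1 / 5 : ℝ))) :=
    (measurable_id.pow_const _).ennreal_ofReal
  have hI : ∫⁻ t in Ioi 0, μ {z | t < g z} * ENNReal.ofReal (t ^ ((2 : ℝ) - 1)) ≤
      Λ * ENNReal.ofReal (5 / 4 * m ^ (4 / 5 : ℝ)) := by
    calc ∫⁻ t in Ioi 0, μ {z | t < g z} * ENNReal.ofReal (t ^ ((2 : ℝ) - 1))
        ≤ ∫⁻ t in Ioi 0, (Iio m).indicator (fun t => Λ * ENNReal.ofReal (t ^ (-(1 / 5 : ℝ)))) t :=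
          setLIntegral_mono' measurableSet_Ioi fun t ht => hlev t ht
      _ = ∫⁻ t in Ioo 0 m, Λ * ENNReal.ofReal (t ^ (-(1 / 5 : ℝ))) := by
          rw [lintegral_indicator measurableSet_Iio, Measure.restrict_restrict measurableSet_Iio,
            Iio_inter_Ioi]
      _ = Λ * ∫⁻ t in Ioo 0 m, ENNReal.ofReal (t ^ (-(1 / 5 : ℝ))) := lintegral_const_mul _ hmeas_t
      _ = Λ * ENNReal.ofReal (5 / 4 * m ^ (4 / 5 : ℝ)) := by rw [hJ]
  calc ENNReal.ofReal 2 * ∫⁻ t in Ioi 0, μ {z | t < g z} * ENNReal.ofReal (t ^ ((2 : ℝ) - 1))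
      ≤ ENNReal.ofReal 2 * (Λ * ENNReal.ofReal (5 / 4 * m ^ (4 / 5 : ℝ))) := mul_le_mul' le_rfl hI
    _ = Λ * ENNReal.ofReal (5 / 2 * m ^ (4 / 5 : ℝ)) := by
        rw [mul_left_comm, ← ENNReal.ofReal_mul (by norm_num : (0 : ℝ) ≤ 2)]
        congr 2
        ring

/-! ### Cauchy–Schwarz against a translate -/

/-- `∫ Φ(x) F(x − z) dx ≤ ‖Φ‖₂ ‖F‖₂`. [folklore] -/
private theorem lintegral_mul_comp_sub_le_sqrt_w {Φ F : (EuclideanSpace ℝ (Fin 3)) → ℝ≥0∞}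
    (hΦ : Measurable Φ) (hF : Measurable F) (z : (EuclideanSpace ℝ (Fin 3))) :
    ∫⁻ x, Φ x * F (x - z) ≤ (∫⁻ x, Φ x ^ 2) ^ (1 / 2 : ℝ) * (∫⁻ y, F y ^ 2) ^ (1 / 2 : ℝ) := by
  have hFz : Measurable fun x => F (x - z) := hF.comp (measurable_id.sub measurable_const)
  have h := ENNReal.lintegral_mul_le_Lp_mul_Lq volume Real.HolderConjugate.two_two
    hΦ.aemeasurable hFz.aemeasurable
  have htr : ∫⁻ x, (fun x => F (x - z)) x ^ (2 : ℝ) = ∫⁻ y, F y ^ (2 : ℝ) :=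
    lintegral_sub_right_eq_self (fun y => F y ^ (2 : ℝ)) z
  simp only [Pi.mul_apply] at h
  rw [htr] at h
  have e2 : ∀ (G : (EuclideanSpace ℝ (Fin 3)) → ℝ≥0∞), ∫⁻ x, G x ^ (2 : ℝ) = ∫⁻ x, G x ^ 2 := fun G =>
    lintegral_congr fun x => by rw [show (2 : ℝ) = ((2 : ℕ) : ℝ) by norm_num, ENNReal.rpow_natCast]
  rw [e2, e2] at h
  exact h

/-! ### The two-level bound -/

/-- **Two-level bound for the bilinear convolution form with a weak-`L^{6/5}` kernel on `ℝ³`**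
(the tree's Lorentz-free form of the step "weak Young `‖K ∗ f‖₃ ≤ c‖K‖_{6/5,w}‖f‖₂`, then Hölder
`(4,4,2)`" of Grujić–Zhang's proof of Thm. 1.2 at the endpoint `q = 2`). For measurable
`Φ, F, k : ℝ³ → [0, ∞]` with `s^{6/5}|{k > s}| ≤ Λ` (`s > 0`) and every level `m > 0`,
`∫ Φ(x)(∫F(y)k(x−y)dy)dx ≤ 6Λ m^{-1/5} ‖Φ‖₂‖F‖₂ + (5Λ m^{4/5}/2)^{1/2} ‖F‖₂‖Φ‖₁`
(high levels by Tonelli and Cauchy–Schwarz in `x`, low levels by Cauchy–Schwarz in `y`). [cite: GrujicZhang2006, Thm. 1.2 (proof, p. 563) with Thm. 1.1 (proof, (3.7)–(3.8))] -/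
theorem lintegral_mul_lintegral_le_of_weak {Φ F k : (EuclideanSpace ℝ (Fin 3)) → ℝ≥0∞}
    (hΦ : Measurable Φ) (hF : Measurable F) (hk : Measurable k) {Λ : ℝ≥0∞}
    (hweak : ∀ s : ℝ, 0 < s →
      ENNReal.ofReal s ^ (6 / 5 : ℝ) * volume {z | ENNReal.ofReal s < k z} ≤ Λ)
    {m : ℝ} (hm : 0 < m) :
    ∫⁻ x, Φ x * ∫⁻ y, F y * k (x - y) ≤
      Λ * ENNReal.ofReal (6 * m ^ (-(1 / 5 : ℝ))) *
          ((∫⁻ x, Φ x ^ 2) ^ (1 / 2 : ℝ) * (∫⁻ y, F y ^ 2) ^ (1 / 2 : ℝ)) +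
        (Λ * ENNReal.ofReal (5 / 2 * m ^ (4 / 5 : ℝ))) ^ (1 / 2 : ℝ) *
          (∫⁻ y, F y ^ 2) ^ (1 / 2 : ℝ) * ∫⁻ x, Φ x := by
  -- the two levels of the kernel
  set B : Set (EuclideanSpace ℝ (Fin 3)) := {z | ENNReal.ofReal m < k z} with hB
  have hBm : MeasurableSet B := measurableSet_lt measurable_const hk
  set kb : (EuclideanSpace ℝ (Fin 3)) → ℝ≥0∞ := B.indicator k with hkb
  set ks : (EuclideanSpace ℝ (Fin 3)) → ℝ≥0∞ := Bᶜ.indicator k with hks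
  have hkbm : Measurable kb := hk.indicator hBm
  have hksm : Measurable ks := hk.indicator hBm.compl
  have hsplitk : ∀ z, k z = kb z + ks z := fun z =>
    (congrFun (Set.indicator_self_add_compl B k) z).symm
  set P : ℝ≥0∞ := (∫⁻ x, Φ x ^ 2) ^ (1 / 2 : ℝ) * (∫⁻ y, F y ^ 2) ^ (1 / 2 : ℝ) with hP
  set Cn : ℝ≥0∞ := Λ * ENNReal.ofReal (6 * m ^ (-(1 / 5 : ℝ))) with hCn
  set Cf : ℝ≥0∞ := (Λ * ENNReal.ofReal (5 / 2 * m ^ (4 / 5 : ℝ))) ^ (1 / 2 : ℝ) with hCf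
  -- the inner integral split by levels; the high part recentred at `x`
  set near : (EuclideanSpace ℝ (Fin 3)) → ℝ≥0∞ := fun x => ∫⁻ z, kb z * (Φ x * F (x - z)) with hnear
  set far : (EuclideanSpace ℝ (Fin 3)) → ℝ≥0∞ := fun x => ∫⁻ y, F y * ks (x - y) with hfar
  have hsplit : ∀ x, Φ x * ∫⁻ y, F y * k (x - y) = near x + Φ x * far x := by
    intro x
    have h1 : ∫⁻ y, F y * k (x - y) = (∫⁻ y, F y * kb (x - y)) + ∫⁻ y, F y * ks (x - y) := by
      have hm1 : Measurable fun y => F y * kb (x - y) :=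
        hF.mul (hkbm.comp (measurable_const.sub measurable_id))
      rw [← lintegral_add_left hm1]
      exact lintegral_congr fun y => by rw [hsplitk (x - y), mul_add]
    have h2 : ∫⁻ y, F y * kb (x - y) = ∫⁻ z, kb z * F (x - z) := by
      have h := lintegral_sub_left_eq_self (μ := (volume : Measure (EuclideanSpace ℝ (Fin 3))))
        (fun z => kb z * F (x - z)) x
      simp only [sub_sub_cancel] at h
      rw [← h]
      exact lintegral_congr fun y => mul_comm _ _
    have hm2 : Measurable fun z => kb z * F (x - z) :=
      hkbm.mul (hF.comp (measurable_const.sub measurable_id))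
    rw [h1, mul_add, h2, ← lintegral_const_mul _ hm2]
    congr 1
    exact lintegral_congr fun z => by ring
  -- measurability of the near integrand on the product
  have hprod : Measurable (uncurry fun x z : (EuclideanSpace ℝ (Fin 3)) => kb z * (Φ x * F (x - z))) :=
    Measurable.mul (hkbm.comp measurable_snd)
      ((hΦ.comp measurable_fst).mul (hF.comp (measurable_fst.sub measurable_snd)))
  have hnear_m : Measurable near := Measurable.lintegral_prod_right hprod
  -- ### the high levels: Tonelli and Cauchy–Schwarz in `x`
  have hnear_le : ∫⁻ x, near x ≤ Cn * P := by
    have hswap : ∫⁻ x, near x = ∫⁻ z, ∫⁻ x, kb z * (Φ x * F (x - z)) :=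
      lintegral_lintegral_swap hprod.aemeasurable
    rw [hswap]
    have hin : ∀ z, ∫⁻ x, kb z * (Φ x * F (x - z)) ≤ kb z * P := by
      intro z
      have hmx : Measurable fun x => Φ x * F (x - z) :=
        hΦ.mul (hF.comp (measurable_id.sub measurable_const))
      rw [lintegral_const_mul _ hmx]
      exact mul_le_mul' le_rfl (lintegral_mul_comp_sub_le_sqrt_w hΦ hF z)
    calc ∫⁻ z, ∫⁻ x, kb z * (Φ x * F (x - z)) ≤ ∫⁻ z, kb z * P := lintegral_mono hin
      _ = (∫⁻ z, kb z) * P := lintegral_mul_const _ hkbm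
      _ ≤ Cn * P := mul_le_mul' (lintegral_indicator_level_lt_le_of_weak hk hweak hm) le_rfl
  -- ### the low levels: Cauchy–Schwarz in `y`
  have e2 : ∀ (G : (EuclideanSpace ℝ (Fin 3)) → ℝ≥0∞), ∫⁻ x, G x ^ (2 : ℝ) = ∫⁻ x, G x ^ 2 :=
    fun G => lintegral_congr fun x => by
      rw [show (2 : ℝ) = ((2 : ℕ) : ℝ) by norm_num, ENNReal.rpow_natCast]
  have hfar_pt : ∀ x, far x ≤ (∫⁻ y, F y ^ 2) ^ (1 / 2 : ℝ) * Cf := by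
    intro x
    have hksx : Measurable fun y => ks (x - y) := hksm.comp (measurable_const.sub measurable_id)
    have h := ENNReal.lintegral_mul_le_Lp_mul_Lq volume Real.HolderConjugate.two_two
      hF.aemeasurable hksx.aemeasurable
    simp only [Pi.mul_apply] at h
    rw [e2, e2] at h
    refine h.trans ?_
    have htr : ∫⁻ y, ks (x - y) ^ 2 = ∫⁻ z, ks z ^ 2 :=
      lintegral_sub_left_eq_self (μ := (volume : Measure (EuclideanSpace ℝ (Fin 3)))) (fun z => ks z ^ 2) x
    rw [htr]
    refine mul_le_mul' le_rfl ?_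
    exact ENNReal.rpow_le_rpow (lintegral_indicator_level_le_sq_le_of_weak hk hweak hm) (by norm_num)
  have hfar_le : ∫⁻ x, Φ x * far x ≤ Cf * (∫⁻ y, F y ^ 2) ^ (1 / 2 : ℝ) * ∫⁻ x, Φ x := by
    calc ∫⁻ x, Φ x * far x ≤ ∫⁻ x, Φ x * ((∫⁻ y, F y ^ 2) ^ (1 / 2 : ℝ) * Cf) :=
          lintegral_mono fun x => mul_le_mul' le_rfl (hfar_pt x)
      _ = (∫⁻ x, Φ x) * ((∫⁻ y, F y ^ 2) ^ (1 / 2 : ℝ) * Cf) := lintegral_mul_const _ hΦ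
      _ = Cf * (∫⁻ y, F y ^ 2) ^ (1 / 2 : ℝ) * ∫⁻ x, Φ x := by ring
  -- ### assembly
  calc ∫⁻ x, Φ x * ∫⁻ y, F y * k (x - y) = ∫⁻ x, (near x + Φ x * far x) :=
        lintegral_congr fun x => hsplit x
    _ = (∫⁻ x, near x) + ∫⁻ x, Φ x * far x := lintegral_add_left hnear_m _
    _ ≤ Cn * P + Cf * (∫⁻ y, F y ^ 2) ^ (1 / 2 : ℝ) * ∫⁻ x, Φ x := add_le_add hnear_le hfar_le

end Literature.Analysis.FluidPDE

end
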